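import Summits.RiemannHypothesis.RiemannHypothesis.Theorems.WeilTwoPrimeDeflE25EBase
import Literature.NumberTheory.LFunctions.WeilBlockRowsFast
import HarnessLib

/-!
# Even-sector deflated two-prime certificate E25E: the even Bessel block claim `Hp = C H Cᵀ`, rows 80–84, fast check

`WeilCert.checkHpRowT` (linear traversals, triangular `C`) + `WeilCert.checkHpRow_of_T` for certificate E25E (even block). Pure proof file.
-/

set_option linter.dupNamespace false

noncomputable section

namespace Summit.RiemannHypothesis.RiemannHypothesis.Theorems.EvenWinsBeyondArch

open Literature.NumberTheory.LFunctions

set_option maxHeartbeats 0 in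
/-- Fast kernel check of claim row 80 of `Hp = C H Cᵀ` (even block, certificate E25E). [folklore] -/
theorem checkHpRowT0_80_weilCertDeflE25E : weilCertDeflE25EBase.checkHpRowT weilCertDeflE25EHpE 0 80 = true := by
  decide +kernel

/-- Claim row 80 of `Hp = C H Cᵀ` (even block, certificate E25E), from the fast check. [folklore] -/
theorem checkHpRow0_80_weilCertDeflE25E : weilCertDeflE25EBase.checkHpRow weilCertDeflE25EHpE 0 80 = true :=
  WeilCert.checkHpRow_of_T checkHpRowT0_80_weilCertDeflE25E

set_option maxHeartbeats 0 in
/-- Fast kernel check of claim row 81 of `Hp = C H Cᵀ` (even block, certificate E25E). [folklore] -/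
theorem checkHpRowT0_81_weilCertDeflE25E : weilCertDeflE25EBase.checkHpRowT weilCertDeflE25EHpE 0 81 = true := by
  decide +kernel

/-- Claim row 81 of `Hp = C H Cᵀ` (even block, certificate E25E), from the fast check. [folklore] -/
theorem checkHpRow0_81_weilCertDeflE25E : weilCertDeflE25EBase.checkHpRow weilCertDeflE25EHpE 0 81 = true :=
  WeilCert.checkHpRow_of_T checkHpRowT0_81_weilCertDeflE25E

set_option maxHeartbeats 0 in
/-- Fast kernel check of claim row 82 of `Hp = C H Cᵀ` (even block, certificate E25E). [folklore] -/
theorem checkHpRowT0_82_weilCertDeflE25E : weilCertDeflE25EBase.checkHpRowT weilCertDeflE25EHpE 0 82 = true := by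
  decide +kernel

/-- Claim row 82 of `Hp = C H Cᵀ` (even block, certificate E25E), from the fast check. [folklore] -/
theorem checkHpRow0_82_weilCertDeflE25E : weilCertDeflE25EBase.checkHpRow weilCertDeflE25EHpE 0 82 = true :=
  WeilCert.checkHpRow_of_T checkHpRowT0_82_weilCertDeflE25E

set_option maxHeartbeats 0 in
/-- Fast kernel check of claim row 83 of `Hp = C H Cᵀ` (even block, certificate E25E). [folklore] -/
theorem checkHpRowT0_83_weilCertDeflE25E : weilCertDeflE25EBase.checkHpRowT weilCertDeflE25EHpE 0 83 = true := by
  decide +kernel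

/-- Claim row 83 of `Hp = C H Cᵀ` (even block, certificate E25E), from the fast check. [folklore] -/
theorem checkHpRow0_83_weilCertDeflE25E : weilCertDeflE25EBase.checkHpRow weilCertDeflE25EHpE 0 83 = true :=
  WeilCert.checkHpRow_of_T checkHpRowT0_83_weilCertDeflE25E

set_option maxHeartbeats 0 in
/-- Fast kernel check of claim row 84 of `Hp = C H Cᵀ` (even block, certificate E25E). [folklore] -/
theorem checkHpRowT0_84_weilCertDeflE25E : weilCertDeflE25EBase.checkHpRowT weilCertDeflE25EHpE 0 84 = true := by
  decide +kernel

/-- Claim row 84 of `Hp = C H Cᵀ` (even block, certificate E25E), from the fast check. [folklore] -/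
theorem checkHpRow0_84_weilCertDeflE25E : weilCertDeflE25EBase.checkHpRow weilCertDeflE25EHpE 0 84 = true :=
  WeilCert.checkHpRow_of_T checkHpRowT0_84_weilCertDeflE25E


end Summit.RiemannHypothesis.RiemannHypothesis.Theorems.EvenWinsBeyondArch
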